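import Summits.AtomisticToContinuum.Crystallization.Theses.PalmUnimodularRigidity
import Summits.AtomisticToContinuum.Crystallization.Theorems.LayeredLawsSelectHcp.Negative.RootedRedundant
import Literature.MathematicalPhysics.StatisticalMechanics.BarlowStackingEnergy
import HarnessLib.Audit

/-!
# Line `stress-jump-young-hagg-density` — skeleton for crux `LayeredLawsSelectHcp`
# (stmt-AtomisticToContinuum-9226, route `PalmUnimodularRigidity`, rank 3)

Crux (unbundled by the standing disprover, `Negative.DiracLaws.crux_iff`, and freed of H1 by
`Negative.RootedRedundant.crux_iff_without_rooted`): every probability law `P` on rooted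
configurations of `ℝ³` which is POINT-STATIONARY (Mecke), MINIMISING (`E_P[h] ≤ e*`) and LAYERED
(a.s. `count|S`, every point of `S` with a `(1/100)`-good fcc/hcp shell at a scale in `[9/10,1]`,
`S` globally bond-isomorphic to an ideal Barlow stacking) is a.s. an exact rotated relaxed hcp
crystal with optimal parameters (`IsRelaxedHcp`).

## The line (idea card `Ideas/stress-jump-young-hagg-density.md`, triage r1: 3 × pass)

SELECTION HALF (this card) ∘ RIGIDITY HALF (sibling cards `mtp-prestress-split-ergodic-frame`,
`stacking-blind-coercivity-transfer` ≈ `kyp-bilayer-transfer-certificate`), glued at the measure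
level where "fault density `0`" means "no fault almost surely":

* A stacking fault through a point `x` of a Barlow-like configuration is an INTRINSIC bond-graph
  event: `x` is a CUBIC site (cuboctahedral shell; Hägg letters `s m = s (m-1)` at its layer) iff
  no bonded pair of its neighbours has two common bonded neighbours (`IsHexSite` / `IsCubicSite`,
  §1) — chart-free and translation-covariant, so `ρ_c := P(root cubic)` IS the fault density and
  the orientation problem flagged by all three triagers (the `⅓`-to-the-upper-struts transport)
  never arises: every transport below runs along the symmetric bond relation.
* The REFERENCE of a sample is the IDEAL STACKING OF ITS OWN WORD at hcp's relaxed cell `(a*,h*)`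
  (`Chart`, `refSiteEnergy`, §2): `E_P[h] − e(hcp a* h*) = {E[ref] − e(hcp*)} + {E[h] − E[ref]}`.
* `stub_haggDensityStep` (M/L, zeroth order): `E[ref] ≥ e(hcp a h) + m_H·ρ_c` for EVERY
  point-stationary layered law and every cell of the box — Hägg domination WITH THE FAULT TERM
  (`stub_haggDominationWithFaults`, deterministic, provable now: the `+ m_H·b` Peierls count of
  0737) in expectation under the layer-chain stationarity that Mecke gives along the symmetric
  `1/6`-transport to the six adjacent-layer bond-neighbours (`P = ½(TP + T⁻¹P) ⇒ TP = P`).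
* `stub_relaxationStep` (XL, THE LEVER — "faults push, they do not pull sideways"):
  `E[h] ≥ E[ref] − (1/10)·m_H·ρ_c`: relaxation can recover at most a tenth of the Hägg cost per
  unit fault density. First order = the WORK of the reference's site forces, which are vertical,
  layer-uniform, self-equilibrated and supported within two layers of a fault
  (`stub_idealStackingForces`), of size `≤ Σ_k k|g_k| ≤ 24|J₂|` (`stub_referenceCell`), hence
  Young-bounded by `5·(24 J₂)²/(2 c_gap) ≈ 4e-3·m_H` per unit `ρ_c` (single fault: `2g₂²/(2c_gap)
  = 2.7e-4·m_H`); the mean-strain work vanishes by ZERO STRESS of hcp at `(a*,h*)`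
  (`stub_referenceCell` (i)); second order = WORD-UNIFORM tube coercivity of the remainder with
  reference `X_s` — CONSUMED from the sibling lines (common layer-transfer storage found feasible
  with zero loss at triage: kit j012751 §A, j012726 §D).
* Sandwich (glue, proved here): `E_P[h] ≤ e* ≤ e(hcp a* h*)` (`eStar_le`) forces
  `(9/10)·m_H·ρ_c ≤ 0`, `m_H > 0` by `stub_referenceCell` (ii), so `ρ_c = 0`.
* `stub_nullCubicRootGivesHcpWord` (M): Palm transfer "root a.s. not cubic ⇒ no cubic site
  a.s." + the combinatorial identification "Barlow-like with no cubic site ⇒ bond-isomorphic to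
  the IDEAL HCP stacking" (`BarlowCoordination.dist_barlowPos_eq_iff`).
* `stub_hcpWordRigidity` (XL, the rigidity half, consumed): a minimising point-stationary law that
  is a.s. hcp-WORDED is a.s. an exact rotated relaxed hcp crystal with `e(hcp a h) = e*`.

`LayeredLawsSelectHcp_of` composes the seven stubs into the crux BY NAME (kernel-checked, no
`sorry`; glue = `crux_iff_without_rooted` + `selectionInequality_of` + `eStar_le` +
`c·P(E) ≤ 0 ⇒ P(E) = 0`).

## Disproof used (`Cruxes/LayeredLawsSelectHcp/Disproof.lean`, gen 1; landed parts
`Theorems/LayeredLawsSelectHcp/Negative/*`, imported here through `Negative.RootedRedundant`)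

* `layeredLawsSelectHcp_false_without_energy` (H3 load-bearing, witness `fccLaw`): honoured — H3
  is used at exactly two named places: the sandwich in `LayeredLawsSelectHcp_of` (`ρ_c = 0`) and
  inside `stub_hcpWordRigidity` (pinning `(a,h)`, killing the strain). `stub_haggDensityStep` and
  `stub_relaxationStep` have NO minimality hypothesis; the fcc law is their tightness example
  (`ρ_c = 1`, forces `≡ 0`, `E[ref] − e(hcp*) = e_fcc(a*,h*) − e_hcp* = 7.26e-5` vs `m_H = 7.25e-5`
  — equal to three digits, as it must; relaxation gain `e_fcc(a*,h*) − e_fcc* ≈ 1e-7 ≪ m_H/10`).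
* `layeredLawsSelectHcp_false_of_fcc_rootEnergy_le` / `_of_periodic_competitor`: the contrapositive
  companions of `selectionInequality_of` — life or death of the line is the sign of
  `m_H − losses`, i.e. the certified numbers of `stub_referenceCell` (J₂ < 0, domination ≥ 287,
  `Σk|g_k| = 16.7|J₂|`, `c_gap = 18.9`: kit j012726 / j012751 / j012659 at triage).
* `crux_iff_without_rooted` (H1 redundant): used verbatim as the first step of the composition.
* `goodShell_barlowStacking_ideal` / `barlowLike_barlowStacking_ideal` (H4 blind to the word):
  consistent — the word is read from the bond graph (`IsCubicSite`), selection is energetic.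
* Mutation notes: `δ` never used; `∃ A` and free `(a,h)` untouched (inside `stub_hcpWordRigidity`).
No stub is an instance of a landed Negative lemma: the measure-level stubs hold for `fccLaw`
(resp. vacuously: fcc is not hcp-worded) and for the Palm laws of all ideal polytypes.
-/

noncomputable section

namespace Summit.AtomisticToContinuum.Crystallization.Cruxes.LayeredLawsSelectHcp.StressJumpYoungHaggDensity

open MeasureTheory Set
open Literature.MathematicalPhysics.StatisticalMechanics Literature.Geometry.DiscreteGeometry
open Summit.AtomisticToContinuum.Crystallization.Theses.PalmUnimodularRigidity (LayeredLawsSelectHcp)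
open Summit.AtomisticToContinuum.Crystallization.Theorems.ChargedEnergyGapNegative (eStar eStar_le)
open Summit.AtomisticToContinuum.Crystallization.Theorems.LayeredLawsSelectHcp.Negative.DiracLaws
  (Rooted PointStationary meanRootEnergy GoodShell BarlowLike Layered IsRelaxedHcp crux_iff)
open Summit.AtomisticToContinuum.Crystallization.Theorems.LayeredLawsSelectHcp.Negative.RootedRedundant
  (crux_iff_without_rooted)

/-- Euclidean `3`-space. -/
local notation "E3" => EuclideanSpace ℝ (Fin 3)

/-! ## §1 Intrinsic objects: points, bonds, cubic (faulted) sites, hcp-worded configurations -/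

/-- The points (atoms) of a configuration measure: `pts (count|S) = S` (`pts_count_restrict`). -/
def pts (μ : Measure E3) : Set E3 := {y | μ {y} ≠ 0}

/-- The BOND relation of a configuration `S`: two points of `S` at distance in `(0, 28/25]`
(the window of H4's bond-isomorphism; in a layered configuration these are exactly the images of
the touching pairs of the ideal stacking). Symmetric, irreflexive, translation-covariant. -/
def Bond (S : Set E3) (x y : E3) : Prop :=
  x ∈ S ∧ y ∈ S ∧ 0 < dist x y ∧ dist x y ≤ 28 / 25

/-- `x` is a HEXAGONAL (hcp-like, anticuboctahedral) site of `S`: some bonded pair `p ~ q` of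
neighbours of `x` has TWO distinct common neighbours `t, b` that are also neighbours of `x` (two
shell triangles sharing the shell edge `pq` — the signature of the triangular orthobicupola; in the
cuboctahedron every edge lies in exactly one triangle). In an ideal Barlow stacking the site
`barlowPos s m i j` is hexagonal iff `s m = -s (m-1)` (`BarlowCoordination.dist_barlowPos_eq_iff`:
the upper and lower neighbour triples `threeOffsets (-s m)`, `threeOffsets (s (m-1))` coincide). -/
def IsHexSite (S : Set E3) (x : E3) : Prop :=
  ∃ p q t b : E3, t ≠ b ∧ Bond S x p ∧ Bond S x q ∧ Bond S x t ∧ Bond S x b ∧ Bond S p q ∧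
    Bond S t p ∧ Bond S t q ∧ Bond S b p ∧ Bond S b q

/-- `x` is a CUBIC (fcc-like, cuboctahedral) site of `S` — a stacking fault passes through `x`
(Hägg letters `s m = s (m-1)` at its layer): a point of `S` that is not hexagonal. -/
def IsCubicSite (S : Set E3) (x : E3) : Prop :=
  x ∈ S ∧ ¬ IsHexSite S x

/-- The event "the ROOT is a cubic site" (FAULT DENSITY `ρ_c := P cubicRoot`). -/
def cubicRoot : Set (Measure E3) := {μ | IsCubicSite (pts μ) 0}

/-- `S` is bond-isomorphic to the ideal Barlow stacking of the GIVEN word `s`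
(`BarlowLike S ↔ ∃ s, IsHaggSeq s ∧ BarlowLikeWord s S`, `barlowLike_iff`). -/
def BarlowLikeWord (s : ℤ → ℤ) (S : Set E3) : Prop :=
  ∃ Φ : E3 → E3, Set.BijOn Φ (barlowStacking 1 (Real.sqrt (2 / 3)) s) S ∧
    ∀ p ∈ barlowStacking 1 (Real.sqrt (2 / 3)) s, ∀ q ∈ barlowStacking 1 (Real.sqrt (2 / 3)) s,
      (dist p q = 1 ↔ (0 < dist (Φ p) (Φ q) ∧ dist (Φ p) (Φ q) ≤ 28 / 25))

/-- H4 with the word pinned to HCP: a.s. `count|S`, good shells everywhere, and `S` bond-isomorphic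
to the ideal hcp stacking `barlowStacking 1 √(2/3) alternatingHagg`. -/
def LayeredHcp (P : Measure (Measure E3)) : Prop :=
  ∀ᵐ μ ∂P, ∃ S : Set E3, μ = (Measure.count : Measure E3).restrict S ∧
    (∀ x ∈ S, GoodShell S x) ∧ BarlowLikeWord alternatingHagg S

/-! ## §2 The reference: charts, own-word site energy, forces, couplings, the relaxed hcp cell -/

/-- A CHART of the configuration `S` through the point `x`: a Hägg word, a bond-isomorphism from
the ideal stacking of that word onto `S` (H4's data), and the ideal site `(layer, idx₁, idx₂)`
mapped to `x`. Under H4 every point of `S` has charts (`nonempty_chart_of_barlowLikeWord`).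
CHART RIGIDITY (the combinatorial lemma shared by STUBS 4 and 5 and by every own-word-reference
line; size M/L, provable now, rides with `--supports`): two charts of the same `(S, x)` differ by a
graph isomorphism `ψ` of ideal stackings, and `ψ` maps LAYERS to LAYERS and adjacent layers to
adjacent layers — because the layer structure of a Barlow contact graph is intrinsic: hexagonal /
cubic sites are intrinsic (`IsHexSite`), the layer through a hexagonal site `x` is cut out
intrinsically (a neighbour `y` of `x` is in-layer iff `y` is EQUATORIAL in the anticuboctahedral
shell of `x`, i.e. some shell edge `yz` lies on two shell triangles; in-layer adjacency then
generates the layer; in an all-cubic word every layering gives the same data), and from a known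
layer `L` the two neighbouring layers are the two connected components of
`{y ∉ L : #(N(y) ∩ L) = 3}` — so `ψ` induces an isometry of `ℤ` on layer indices preserving the
type sequence, hence the symmetrised alignment data `1[m, m+n aligned] + 1[m−n, m aligned]` and
`barlowSiteEnergy` (any cell `(a,h)`). Consequently `refSiteEnergy` below is chart-independent and
a Borel function of the type pattern seen from `x` on the layered carrier (the measurability that
the Bochner integrals of STUBS 4–5 need). Alternative packaging (triage r1-2): carry a uniformly
randomised chart as a covariant mark — finiteness of the charts through a point modulo the ideal
point group is the same rigidity lemma. -/
structure Chart (S : Set E3) (x : E3) where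
  /-- the Hägg word of the chart -/
  word : ℤ → ℤ
  /-- the bond-isomorphism from the ideal stacking of `word` onto `S` -/
  toFun : E3 → E3
  /-- layer index of the ideal site mapped to `x` -/
  layer : ℤ
  /-- first in-layer index of the ideal site mapped to `x` -/
  idx₁ : ℤ
  /-- second in-layer index of the ideal site mapped to `x` -/
  idx₂ : ℤ
  isHagg : IsHaggSeq word
  bijOn : Set.BijOn toFun (barlowStacking 1 (Real.sqrt (2 / 3)) word) S
  bond_iff : ∀ p ∈ barlowStacking 1 (Real.sqrt (2 / 3)) word,
    ∀ q ∈ barlowStacking 1 (Real.sqrt (2 / 3)) word,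
      (dist p q = 1 ↔ (0 < dist (toFun p) (toFun q) ∧ dist (toFun p) (toFun q) ≤ 28 / 25))
  map_site : toFun (barlowPos 1 (Real.sqrt (2 / 3)) word layer idx₁ idx₂) = x

/-- The OWN-WORD REFERENCE ENERGY of the site `x` of `S` at the cell `(a, h)`: the energy
`barlowSiteEnergy lennardJones a h s m` of the corresponding site of the IDEAL stacking, with
uniform spacings `(a, h)`, of the word `s` of a chart of `S` through `x` (layer `m`); `0` if `S` has
no chart through `x` (a null event under H2 ∧ H4). By `barlowSiteEnergy_eq` it equals
`e₀(a,h) + ½ Σ_{k≥2} J_k(a,h)·(1[layers m, m+k aligned] + 1[layers m−k, m aligned])`. -/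
def refSiteEnergy (a h : ℝ) (S : Set E3) (x : E3) : ℝ :=
  haveI := Classical.propDecidable (Nonempty (Chart S x))
  if H : Nonempty (Chart S x) then
    barlowSiteEnergy lennardJones a h (Classical.choice H).word (Classical.choice H).layer
  else 0

/-- The HÄGG MARGIN `m_H(a,h) = −J₂ − Σ_{k≥3} (k−1)|J_k|` (`J_k = barlowCoupling lennardJones a h k`):
the zeroth-order cost of one stacking fault (`7.25e-5` at `(a*,h*)`, positive iff `J₂ < 0` and
domination; `≥ |J₂|/2` under 3063's half-domination). -/
def haggMargin (a h : ℝ) : ℝ :=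
  -barlowCoupling lennardJones a h 2 -
    ∑' k : ℕ, (if 3 ≤ k then ((k : ℝ) - 1) * |barlowCoupling lennardJones a h k| else 0)

/-- `V_LJ'(r) = −r⁻¹³ + r⁻⁷` for `V_LJ = r⁻¹²/12 − r⁻⁶/6`. -/
def ljDeriv (r : ℝ) : ℝ := -(r⁻¹) ^ 13 + (r⁻¹) ^ 7

/-- `V_LJ''(r) = 13 r⁻¹⁴ − 7 r⁻⁸`. -/
def ljDeriv2 (r : ℝ) : ℝ := 13 * (r⁻¹) ^ 14 - 7 * (r⁻¹) ^ 8

/-- The FORCE on the site `x = barlowPos a h s m 0 0` of the ideal Barlow stacking of word `s`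
with uniform spacings `(a, h)`: `F = Σ_{y ≠ x} V'(‖y − x‖) (y − x)/‖y − x‖ = −∇ₓ(site energy)`
(a `tsum` in `E3`; the same at every site of layer `m` by the in-layer translations). -/
def siteForce (a h : ℝ) (s : ℤ → ℤ) (m : ℤ) : E3 :=
  ∑' y : {y : E3 // y ∈ barlowStacking a h s ∧ y ≠ barlowPos a h s m 0 0},
    (ljDeriv (dist (barlowPos a h s m 0 0) y.1) / dist (barlowPos a h s m 0 0) y.1) •
      (y.1 - barlowPos a h s m 0 0)

/-- Vertical force exerted on a particle by a FULL triangular layer at signed layer distance `k`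
and letter offset `δ` (vectors `layerVec a h δ k i j`, vertical component `k h`):
`Σ_{ij} V'(r) (k h)/r` — the `t`-derivative of the layer interaction `t ↦ Σ V(√(ρ² + t²))` at
`t = k h`, written as an explicit lattice sum (no `deriv`). -/
def layerVerticalForce (a h : ℝ) (δ k : ℤ) : ℝ :=
  ∑' ij : ℤ × ℤ, ljDeriv ‖layerVec a h δ k ij.1 ij.2‖ * ((k : ℝ) * h) / ‖layerVec a h δ k ij.1 ij.2‖

/-- The LAYER FORCE COUPLING `g_k(a,h)`: aligned-minus-non-aligned vertical force of a layer at
distance `k` (`= (1/k) ∂_h J_k`, `J_k = barlowCoupling lennardJones a h k`; numerically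
`g₂(a*,h*) = +6.06e-4 = 8.3 |J₂|`, `g₃ = 7e-7`, kit j012751 §C). -/
def forceCoupling (a h : ℝ) (k : ℕ) : ℝ :=
  layerVerticalForce a h 0 k - layerVerticalForce a h 1 k

/-- Second `t`-derivative of the interaction with one layer (offset `δ`, signed distance `k`,
`t = k h`): `Σ_{ij} [V''(r) t²/r² + V'(r) (r² − t²)/r³]`, as an explicit lattice sum. -/
def layerStiffness (a h : ℝ) (δ k : ℤ) : ℝ :=
  ∑' ij : ℤ × ℤ,
    (ljDeriv2 ‖layerVec a h δ k ij.1 ij.2‖ * ((k : ℝ) * h) ^ 2 / ‖layerVec a h δ k ij.1 ij.2‖ ^ 2 +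
      ljDeriv ‖layerVec a h δ k ij.1 ij.2‖ * (‖layerVec a h δ k ij.1 ij.2‖ ^ 2 - ((k : ℝ) * h) ^ 2) /
        ‖layerVec a h δ k ij.1 ij.2‖ ^ 3)

/-- GAP STIFFNESS `c_gap(a,h) = Φ_N''(h) − Σ_{k≥2} k² (min_type Φ''(kh))⁻`: a lower bound for the
Hessian, in the layer spacings, of the rigid-layer chain of ANY word at uniform spacing `h`
(Cauchy–Schwarz on the `k`-windows); numerically `18.9` at `(a*,h*)` (kit j012659 §D). -/
def gapStiffness (a h : ℝ) : ℝ :=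
  layerStiffness a h 1 1 -
    ∑' k : ℕ, (if 2 ≤ k then
      (k : ℝ) ^ 2 * max 0 (-min (layerStiffness a h 0 k) (layerStiffness a h 1 k)) else 0)

/-- Energy of the site `0` of the relaxed hcp stacking `hcpStacking a h`: `½ Σ_{y ≠ 0} V_LJ ‖y‖`
(= the energy per particle `e(hcp a h)` by vertex-transitivity, `HcpHomogeneous`). -/
def hcpSiteEnergy (a h : ℝ) : ℝ :=
  (1 / 2) * ∑' y : {y : E3 // y ∈ hcpStacking a h ∧ y ≠ 0}, lennardJones ‖y.1‖

/-- The static (virial) SITE STRESS of hcp at the origin: `S_ij = Σ_{y ≠ 0} V'(‖y‖) yᵢ yⱼ/‖y‖`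
(first variation of the site energy under the affine map `y ↦ (1 + G) y` is `S : G`). -/
def hcpSiteStress (a h : ℝ) (i j : Fin 3) : ℝ :=
  ∑' y : {y : E3 // y ∈ hcpStacking a h ∧ y ≠ 0}, ljDeriv ‖y.1‖ * (y.1 i * y.1 j) / ‖y.1‖

/-- Number of BAD HÄGG BONDS (`s (m+1) = s m`, i.e. layer `m+1` cubic) among `m < n`. -/
def badBonds (s : ℤ → ℤ) (n : ℕ) : ℕ :=
  ((Finset.range n).filter fun m : ℕ => s ((m : ℤ) + 1) = s m).card

/-! ## §3 The statements of the seven stubs (named `Prop`s; the registered `stub_*` theorems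
below restate them, and `Registered.stub_*` are their name-keyed aliases used as the hypotheses of
`LayeredLawsSelectHcp_of`, as the native skeleton audit requires hypotheses admissible BY NAME —
same device as `Cruxes/MazurKaneLaw/Lines/fibre-toolkit-lp-wall-map.lean`) -/

/-- STUB 1 statement — forces of IDEAL stackings (card's First lemma, deterministic): for every
Hägg word and all spacings `a, h > 0`, the force on every site is VERTICAL (the three-fold axis
through the site maps each coset `L`, `w + L`, `2w + L` to itself) and equals the CUT-FORCE sum
`Σ_{k≥2} g_k (1[layers m, m+k aligned] − 1[layers m−k, m aligned])` (regroup the `tsum` layer by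
layer as in `barlowSiteEnergy_eq`; the non-aligned parts cancel between above and below; `k = 1`
is never aligned). Consequences: layer-uniform, zero for the hcp word (`aligned ↔ k` even on both
sides), supported within two layers of a fault, `|F| ≤ Σ_k k|g_k|` across any cut. -/
def IdealStackingForces : Prop :=
  ∀ (a h : ℝ) (s : ℤ → ℤ), 0 < a → 0 < h → IsHaggSeq s → ∀ m : ℤ,
    siteForce a h s m 0 = 0 ∧ siteForce a h s m 1 = 0 ∧
    siteForce a h s m 2 =
      ∑' k : ℕ, (if 2 ≤ k then forceCoupling a h k *
        ((if HaggAligned s m k then (1 : ℝ) else 0) -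
          (if HaggAligned s (m - k) k then (1 : ℝ) else 0)) else 0)

/-- STUB 2 statement — HÄGG DOMINATION WITH THE FAULT TERM KEPT (the `+ m_H·b` strengthening of
item 0737 that all three triagers asked for; deterministic, provable now by 0737's own Peierls
count): for every `±1` sequence, every `n` and every `J` with `Σ k|J_k| < ∞`,
`n·Σ_{k≥2 even} J_k + m_H(J)·b_n ≤ H_n(J,s) + Σ_k k|J_k|`, where `b_n = badBonds s n` and
`m_H(J) = −J₂ − Σ_{k≥3}(k−1)|J_k|` (no sign hypothesis: `k = 2` contributes exactly
`J₂ (n − b_n)`; for `k ≥ 3` at most `(k−1)(b_n + 1)` windows `m < n` are not clean alternating).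
Item 0737 `HaggDominationAllRanges` is the case `m_H ≥ 0` with the `b`-term dropped
(`haggDominationAllRanges_of`). -/
def HaggDominationWithFaults : Prop :=
  ∀ (J : ℕ → ℝ) (s : ℤ → ℤ) (n : ℕ), IsHaggSeq s → Summable (fun k : ℕ => (k : ℝ) * |J k|) →
    (n : ℝ) * (∑' k : ℕ, (if 2 ≤ k ∧ Even k then J k else 0)) +
        (-J 2 - ∑' k : ℕ, (if 3 ≤ k then ((k : ℝ) - 1) * |J k| else 0)) * (badBonds s n : ℝ) ≤
      haggEnergy n J s + ∑' k : ℕ, (k : ℝ) * |J k|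

/-- STUB 3 statement — the CERTIFIED REFERENCE CELL (certified numerics + compactness; same
Poisson–Bessel / interval-lattice-sum engine as item 3063 `LjRegistryDomination`). On the small box
`B₀ = [24/25, 49/50] × [39/50, 4/5]` (which contains the relaxed hcp cell
`(a*,h*) = (0.97127, 0.79293)`, kit j012751 §F, and sits inside 3063's box):
(i) `∃ (a*,h*)` in the open box, a LOCAL MINIMISER of the hcp site energy with ZERO SITE STRESS
(criticality gives `S₁₁ + S₂₂ = S₃₃ = 0`, the `D₃ₕ` site symmetry the rest; Hessian eigenvalues
`{15.7, 34.0}`); (ii) for all `(a,h) ∈ B₀`: `Σ k|J_k| < ∞`, `J₂ < 0`, `|J₂| ≤ 2e-4`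
(`J₂(a*,h*) = −7.27e-5`), half-domination `Σ_{k≥3}(k−1)|J_k| ≤ |J₂|/2` (ratio `≥ 287`; these three
are 3063 restricted to `B₀`), the CUT-FORCE COUPLING BOUND `Σ_{k≥2} k|g_k| ≤ 24|J₂|` (`16.7|J₂|`
at `(a*,h*)`), and the GAP STIFFNESS bound `c_gap ≥ 12` (`18.9` at `(a*,h*)`). -/
def ReferenceCell : Prop :=
  (∃ a h : ℝ, 24 / 25 < a ∧ a < 49 / 50 ∧ 39 / 50 < h ∧ h < 4 / 5 ∧
      IsLocalMin (fun p : ℝ × ℝ => hcpSiteEnergy p.1 p.2) (a, h) ∧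
      ∀ i j : Fin 3, hcpSiteStress a h i j = 0) ∧
  (∀ a h : ℝ, 24 / 25 ≤ a → a ≤ 49 / 50 → 39 / 50 ≤ h → h ≤ 4 / 5 →
      Summable (fun k : ℕ => (k : ℝ) * |barlowCoupling lennardJones a h k|) ∧
      barlowCoupling lennardJones a h 2 < 0 ∧
      |barlowCoupling lennardJones a h 2| ≤ 1 / 5000 ∧
      (∑' k : ℕ, (if 3 ≤ k then ((k : ℝ) - 1) * |barlowCoupling lennardJones a h k| else 0)) ≤
        (1 / 2) * |barlowCoupling lennardJones a h 2| ∧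
      Summable (fun k : ℕ => (k : ℝ) * |forceCoupling a h k|) ∧
      (∑' k : ℕ, (if 2 ≤ k then (k : ℝ) * |forceCoupling a h k| else 0)) ≤
        24 * |barlowCoupling lennardJones a h 2| ∧
      12 ≤ gapStiffness a h)

/-- STUB 4 statement (M/L) — HÄGG DOMINATION IN DENSITY FORM (zeroth order): for every cell
`(a,h)` of the box `B₀` with `Σ k|J_k| < ∞` and EVERY point-stationary layered probability law,
`e(hcp a h) + m_H(a,h)·ρ_c ≤ E_P[refSiteEnergy a h]`. Proof: `refSiteEnergy = e₀ + ½(haggLocal +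
haggBackward)` at the root's layer of the sample's word (`barlowSiteEnergy_eq`); the type sequence
of the layers seen from the root is SHIFT-STATIONARY (Mecke along the symmetric `1/6`-transport
to the adjacent-layer bond-neighbours, `BarlowCoordination` 12 = 6+3+3, then bounded harmonic
functions on `ℤ`) with `P(layer cubic) = ρ_c`; apply `HaggDominationWithFaults` in windows
`[m−n, m+n)`, take expectations (`E[b_n] = n·ρ_c`) and `n → ∞`; finally `e₀ + Σ_{k even} J_k =
barlowSiteEnergy a h alternatingHagg 0 = hcpSiteEnergy a h = e(hcpPeriodicConfiguration a h)`
(vertex-transitivity; regrouping as in item 3065). Uses chart-independence of `refSiteEnergy`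
(docstring of `Chart`). Tight: for the fcc Palm law both sides differ by `≤ Σ_{k≥3}(k+1)|J_k|`. -/
def HaggDensityStep : Prop :=
  HaggDominationWithFaults →
    ∀ (a h : ℝ) (ha : a ≠ 0) (hh : h ≠ 0), 24 / 25 ≤ a → a ≤ 49 / 50 → 39 / 50 ≤ h → h ≤ 4 / 5 →
      Summable (fun k : ℕ => (k : ℝ) * |barlowCoupling lennardJones a h k|) →
      ∀ P : Measure (Measure E3), IsProbabilityMeasure P → PointStationary P → Layered P →
        (hcpPeriodicConfiguration ha hh).energyPerParticle lennardJones +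
            haggMargin a h * (P cubicRoot).toReal ≤
          ∫ μ, refSiteEnergy a h (pts μ) 0 ∂P

/-- STUB 5 statement (XL, HARDEST — THE LEVER of the line: "Hägg domination survives
relaxation") — at a zero-stress local minimiser `(a,h) ∈ B₀` of the hcp site energy (the cell of
`ReferenceCell` (i)), for EVERY point-stationary layered probability law — no minimality —
relaxation recovers at most a tenth of the Hägg cost: `E_P[refSiteEnergy a h] − (1/10)·m_H·ρ_c ≤
E_P[h]`. Architecture (card + triage sharpenings), with `u` the displacement from the reference
`X_s = barlowStacking a h s` of the sample's own word along its chart: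
(W) first order = `−E[F_{M(root)}·ε(root)]`, `F` the cut force of `IdealStackingForces`
(non-zero on ≤ 5 cuts per cubic layer, `|F| ≤ Σk|g_k| ≤ 24|J₂|` by `ReferenceCell`), `ε` the
layer-mean gap stretch; lateral / in-plane / non-uniform modes decouple at first order because the
force is vertical and layer-uniform (an invariant subspace of the reference Hessian); Young:
`≥ −(5·(24 J₂)²/(2c′))·ρ_c − (c′/2)·E[ε²]`; the mean-strain work `S(a,h) : (G − R₀)` VANISHES by
zero stress (MTP-additivity of mean labelled bond vectors, card `mtp-prestress-split`), and the
residual stress of `X_s`, `O(ρ_c·|∂J|) ≈ 4e-4·ρ_c`, is squared away by the same Young step;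
(C) second order: `E[remainder] ≥ (c′/2)·E[ε²]` with `c′ ≤ c_gap` — WORD-UNIFORM tube coercivity
with reference `X_s`, CONSUMED from the sibling lines (`stacking-blind-coercivity-transfer` /
`kyp-bilayer-transfer-certificate`: common layer-transfer storage, feasible with zero loss,
`λ_T = λ_short(hcp) = 3.647`; `mtp-prestress-split-ergodic-frame`: measure-level Korn frame).
Budget: `5·(24 J₂)²/(2 c_gap) ≤ 5·576·(2e-4)·|J₂|/24 ≈ 2.4e-2·|J₂| ≤ 4.8e-2·m_H < m_H/10` by
`ReferenceCell` (ii) (at `(a*,h*)`: `2.2e-3·m_H`). Kit-testable on uniformly rooted relaxed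
periodic polytypes (dhcp, 9R, single faults in supercells): `e_relaxed ≥ e_ideal-own-word(a*,h*) −
7e-6·ρ_c`. -/
def RelaxationStep : Prop :=
  IdealStackingForces → ReferenceCell →
    ∀ a h : ℝ, 24 / 25 ≤ a → a ≤ 49 / 50 → 39 / 50 ≤ h → h ≤ 4 / 5 →
      IsLocalMin (fun p : ℝ × ℝ => hcpSiteEnergy p.1 p.2) (a, h) →
      (∀ i j : Fin 3, hcpSiteStress a h i j = 0) →
      ∀ P : Measure (Measure E3), IsProbabilityMeasure P → PointStationary P → Layered P →
        (∫ μ, refSiteEnergy a h (pts μ) 0 ∂P) - (1 / 10) * (haggMargin a h * (P cubicRoot).toReal) ≤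
          meanRootEnergy P

/-- STUB 6 statement (M) — PALM TRANSFER + WORD COMBINATORICS: for a point-stationary layered
probability law, "the root is a.s. not cubic" upgrades to "a.s. hcp-worded". (a) Mecke with
`g(μ, y) = 1[y is a cubic site of pts μ, ‖y‖ ≤ R]` (translation-covariance of `IsCubicSite`, hard
core from the good shells: `E[#cubic sites in B_R] = E[μ(B_R); root cubic] = 0`), all `R`;
(b) a Barlow-like `S` with chart `(s, Φ)` has `Φ (barlowPos s m i j)` cubic iff `s m = s (m−1)`
(`dist_barlowPos_eq_iff` transported through the bond-isomorphism: the shell bond graph is the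
cuboctahedron, every edge in exactly one triangle, iff the upper and lower triples differ), so no
cubic site forces `s m = −s (m−1)` for all `m`, `s = ±alternatingHagg`, and `−alternatingHagg` is
absorbed by the isometry `(x₁,x₂,x₃) ↦ (−x₁,−x₂,x₃)` (`haggLabel (−s) = −haggLabel s`). Lean cost:
measurability of the joint cubic-site event (same cost as route item 9228). -/
def NullCubicRootGivesHcpWord : Prop :=
  ∀ P : Measure (Measure E3), IsProbabilityMeasure P → PointStationary P → Layered P →
    P cubicRoot = 0 → LayeredHcp P

/-- STUB 7 statement (XL, the RIGIDITY HALF, consumed from the sibling lines) — a minimising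
point-stationary law that is a.s. HCP-WORDED is a.s. an exact rotated relaxed hcp crystal with
optimal parameters: tube coercivity for the hcp word (`E_P[h] ≥ e(hcp a* h*)`, equality iff zero
strain a.s. — `mtp-prestress-split-ergodic-frame`: MTP-additivity of mean labelled bond vectors +
zero stress + ergodic FJM frame; or the storage certificate of `stacking-blind`/`kyp`), then
`E_P[h] ≤ e* ≤ e(hcp a* h*)` pins equality, `hcp − b = −hcp` (`Negative.IntendedModel`) supplies the
`∃ A`, and `e(hcp a* h*) = e*`. H3 is load-bearing here too (an hcp-worded law at the wrong cell is
layered, stationary and not `IsRelaxedHcp`). The selection problem is ABSENT: this is the crux with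
H4 strengthened to the hcp word (strictly weaker than the crux; `fccLaw` is outside its scope). -/
def HcpWordRigidity : Prop :=
  ∀ P : Measure (Measure E3), IsProbabilityMeasure P → PointStationary P →
    meanRootEnergy P ≤ eStar → LayeredHcp P → ∀ᵐ μ ∂P, IsRelaxedHcp μ

/-- The SELECTION INEQUALITY in density form (the card's headline, DERIVED below from STUBS 2–5
in `selectionInequality_of`): a reference cell `(a,h)` and a constant `c > 0`
(`= (9/10)·m_H(a*,h*) ≈ 6.5e-5`) such that EVERY point-stationary layered probability law — NO
minimality — satisfies `e(hcp a h) + c·P(root cubic) ≤ E_P[h]`. Tight on the fcc Palm law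
(`ρ_c = 1`: `e_fcc* − e_hcp* = 7.25e-5`); at `ρ_c = 0` it is the global minimality of relaxed hcp
among hcp-worded tube configurations. -/
def SelectionInequality : Prop :=
  ∃ a h : ℝ, ∃ ha : a ≠ 0, ∃ hh : h ≠ 0, ∃ c : ℝ, 0 < c ∧
    ∀ P : Measure (Measure E3), IsProbabilityMeasure P → PointStationary P → Layered P →
      (hcpPeriodicConfiguration ha hh).energyPerParticle lennardJones + c * (P cubicRoot).toReal ≤
        meanRootEnergy P

/-! ## §4 The registered stubs -/

/-- STUB 1 (M/L, provable now): forces of ideal stackings are vertical cut-force sums. -/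
theorem stub_idealStackingForces : IdealStackingForces := by
  sorry

/-- STUB 2 (M, provable now): Hägg domination with the fault term (strengthened 0737). -/
theorem stub_haggDominationWithFaults : HaggDominationWithFaults := by
  sorry

/-- STUB 3 (L, certified numerics): the relaxed hcp reference cell and the box numbers. -/
theorem stub_referenceCell : ReferenceCell := by
  sorry

/-- STUB 4 (M/L): Hägg domination in density form — layer-chain stationarity from Mecke. -/
theorem stub_haggDensityStep : HaggDensityStep := by
  sorry

/-- STUB 5 (XL, HARDEST — the stress-jump / Young lever; consumes word-uniform tube coercivity
from the sibling lines): relaxation recovers at most `m_H/10` per unit fault density. -/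
theorem stub_relaxationStep : RelaxationStep := by
  sorry

/-- STUB 6 (M): root a.s. not cubic ⇒ a.s. hcp-worded (Palm transfer + word combinatorics). -/
theorem stub_nullCubicRootGivesHcpWord : NullCubicRootGivesHcpWord := by
  sorry

/-- STUB 7 (XL, rigidity half, consumed): minimising hcp-worded laws are exact relaxed hcp. -/
theorem stub_hcpWordRigidity : HcpWordRigidity := by
  sorry

/-! ### Consistency: each named statement IS its registered stub (definitionally) -/

theorem idealStackingForces_holds : IdealStackingForces := stub_idealStackingForces
theorem haggDominationWithFaults_holds : HaggDominationWithFaults := stub_haggDominationWithFaults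
theorem referenceCell_holds : ReferenceCell := stub_referenceCell
theorem haggDensityStep_holds : HaggDensityStep := stub_haggDensityStep
theorem relaxationStep_holds : RelaxationStep := stub_relaxationStep
theorem nullCubicRootGivesHcpWord_holds : NullCubicRootGivesHcpWord := stub_nullCubicRootGivesHcpWord
theorem hcpWordRigidity_holds : HcpWordRigidity := stub_hcpWordRigidity

/-! ### Name-keyed aliases of the seven statements (the hypotheses of the composition) -/
namespace Registered

/-- Alias of `IdealStackingForces` keyed by the registered stub name. -/
abbrev stub_idealStackingForces : Prop := IdealStackingForces
/-- Alias of `HaggDominationWithFaults` keyed by the registered stub name. -/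
abbrev stub_haggDominationWithFaults : Prop := HaggDominationWithFaults
/-- Alias of `ReferenceCell` keyed by the registered stub name. -/
abbrev stub_referenceCell : Prop := ReferenceCell
/-- Alias of `HaggDensityStep` keyed by the registered stub name. -/
abbrev stub_haggDensityStep : Prop := HaggDensityStep
/-- Alias of `RelaxationStep` keyed by the registered stub name. -/
abbrev stub_relaxationStep : Prop := RelaxationStep
/-- Alias of `NullCubicRootGivesHcpWord` keyed by the registered stub name. -/
abbrev stub_nullCubicRootGivesHcpWord : Prop := NullCubicRootGivesHcpWord
/-- Alias of `HcpWordRigidity` keyed by the registered stub name. -/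
abbrev stub_hcpWordRigidity : Prop := HcpWordRigidity

end Registered

/-! ## §5 Proved glue and sanity lemmas -/

/-- `BarlowLike` is `BarlowLikeWord` for some Hägg word (definitional). -/
theorem barlowLike_iff (S : Set E3) : BarlowLike S ↔ ∃ s : ℤ → ℤ, IsHaggSeq s ∧ BarlowLikeWord s S :=
  Iff.rfl

/-- H4's data at a point IS a chart (so under H4 every point of the carrier has a chart). -/
theorem nonempty_chart_of_barlowLikeWord {s : ℤ → ℤ} {S : Set E3} (hs : IsHaggSeq s)
    (h : BarlowLikeWord s S) {x : E3} (hx : x ∈ S) : Nonempty (Chart S x) := by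
  obtain ⟨Φ, hbij, hiso⟩ := h
  obtain ⟨p, hp, rfl⟩ := hbij.surjOn hx
  obtain ⟨k, i, j, rfl⟩ := hp
  exact ⟨⟨s, Φ, k, i, j, hs, hbij, hiso, rfl⟩⟩

/-- An hcp-worded law is layered (the hcp word is a Hägg word). -/
theorem layered_of_layeredHcp {P : Measure (Measure E3)} (h : LayeredHcp P) : Layered P := by
  filter_upwards [h] with μ ⟨S, hμ, hshell, hword⟩
  exact ⟨S, hμ, hshell, alternatingHagg, isHaggSeq_alternating, hword⟩

/-- The points of a counting measure are its carrier. -/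
theorem pts_count_restrict (S : Set E3) : pts ((Measure.count : Measure E3).restrict S) = S := by
  ext y
  simp only [pts, Set.mem_setOf_eq, Measure.restrict_apply (measurableSet_singleton y)]
  by_cases hy : y ∈ S
  · rw [Set.inter_eq_self_of_subset_left (Set.singleton_subset_iff.2 hy), Measure.count_singleton]
    simp [hy]
  · rw [Set.singleton_inter_eq_empty.2 hy, measure_empty]
    simp [hy]

/-- Bonds are symmetric. -/
theorem Bond.symm {S : Set E3} {x y : E3} (h : Bond S x y) : Bond S y x := by
  obtain ⟨hx, hy, h0, h1⟩ := h
  exact ⟨hy, hx, by rwa [dist_comm], by rwa [dist_comm]⟩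

/-- A cubic site is a point of the configuration. -/
theorem IsCubicSite.mem {S : Set E3} {x : E3} (h : IsCubicSite S x) : x ∈ S := h.1

/-- `STUB 2` strengthens item 0737 `HaggDominationAllRanges` (statement inlined verbatim): under
0737's domination hypothesis `J₂ + Σ_{k≥3}(k−1)|J_k| ≤ 0` the fault term is non-negative and may
be dropped. -/
theorem haggDominationAllRanges_of (H : HaggDominationWithFaults) :
    ∀ (J : ℕ → ℝ) (s : ℤ → ℤ) (n : ℕ), (∀ i, s i = 1 ∨ s i = -1) →
      Summable (fun k : ℕ => (k : ℝ) * |J k|) →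
      J 2 + ∑' k : ℕ, (if 3 ≤ k then ((k : ℝ) - 1) * |J k| else 0) ≤ 0 →
      (n : ℝ) * ∑' k : ℕ, (if 2 ≤ k ∧ Even k then J k else 0) ≤
        (∑ m ∈ Finset.range n, ∑' k : ℕ,
          (if 2 ≤ k ∧ (∑ i ∈ Finset.range k, s ((m : ℤ) + i)) % 3 = 0 then J k else 0)) +
        ∑' k : ℕ, (k : ℝ) * |J k| := by
  intro J s n hs hsum hdom
  have h := H J s n hs hsum
  have hb : (0 : ℝ) ≤ (badBonds s n : ℝ) := Nat.cast_nonneg _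
  have hm : 0 ≤ -J 2 - ∑' k : ℕ, (if 3 ≤ k then ((k : ℝ) - 1) * |J k| else 0) := by linarith
  have hmb := mul_nonneg hm hb
  have he : haggEnergy n J s = ∑ m ∈ Finset.range n, ∑' k : ℕ,
      (if 2 ≤ k ∧ (∑ i ∈ Finset.range k, s ((m : ℤ) + i)) % 3 = 0 then J k else 0) := rfl
  linarith

/-- The Hägg margin is positive on the box: `m_H ≥ |J₂|/2 > 0` from `J₂ < 0` and
half-domination (`ReferenceCell` (ii)). -/
theorem haggMargin_pos {a h : ℝ} (hJ2 : barlowCoupling lennardJones a h 2 < 0)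
    (hdom : (∑' k : ℕ, (if 3 ≤ k then ((k : ℝ) - 1) * |barlowCoupling lennardJones a h k| else 0)) ≤
      (1 / 2) * |barlowCoupling lennardJones a h 2|) :
    0 < haggMargin a h := by
  have habs : |barlowCoupling lennardJones a h 2| = -barlowCoupling lennardJones a h 2 :=
    abs_of_neg hJ2
  unfold haggMargin
  linarith

/-- **The selection inequality from STUBS 2–5** (proved): at the zero-stress cell `(a*,h*)` of
`ReferenceCell` (i), STUB 4 gives `e(hcp*) + m_H ρ_c ≤ E[ref]` and STUB 5 gives
`E[ref] − m_H ρ_c/10 ≤ E_P[h]`, so `c = (9/10)·m_H(a*,h*) > 0` works. -/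
theorem selectionInequality_of (hF : IdealStackingForces) (hH : HaggDominationWithFaults)
    (hR : ReferenceCell) (hZ : HaggDensityStep) (hX : RelaxationStep) : SelectionInequality := by
  rcases id hR with ⟨⟨a, h, ha1, ha2, hh1, hh2, hloc, hstress⟩, hbox⟩
  have ha : a ≠ 0 := (show (0 : ℝ) < a by linarith).ne'
  have hh : h ≠ 0 := (show (0 : ℝ) < h by linarith).ne'
  obtain ⟨hsumJ, hJ2, -, hdom, -⟩ := hbox a h ha1.le ha2.le hh1.le hh2.le
  have hm : 0 < haggMargin a h := haggMargin_pos hJ2 hdom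
  refine ⟨a, h, ha, hh, 9 / 10 * haggMargin a h, by positivity, fun P hP hstat hlay => ?_⟩
  have h1 := hZ hH a h ha hh ha1.le ha2.le hh1.le hh2.le hsumJ P hP hstat hlay
  have h2 := hX hF hR a h ha1.le ha2.le hh1.le hh2.le hloc hstress P hP hstat hlay
  have h3 : 9 / 10 * haggMargin a h * (P cubicRoot).toReal =
      9 / 10 * (haggMargin a h * (P cubicRoot).toReal) := by ring
  linarith

/-- From `c·(P E).toReal ≤ 0` with `c > 0`, a finite measure does not charge `E`. -/
theorem measure_eq_zero_of_mul_toReal_nonpos {P : Measure (Measure E3)} [IsFiniteMeasure P]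
    {E : Set (Measure E3)} {c : ℝ} (hc : 0 < c) (h : c * (P E).toReal ≤ 0) : P E = 0 := by
  have h0 : (P E).toReal ≤ 0 := by
    by_contra hlt
    linarith [mul_pos hc (not_le.mp hlt)]
  have h1 : (P E).toReal = 0 := le_antisymm h0 ENNReal.toReal_nonneg
  rcases (ENNReal.toReal_eq_zero_iff _).1 h1 with h2 | h2
  · exact h2
  · exact absurd h2 (measure_ne_top P E)

/-- **Fault density zero** (proved glue): under the selection inequality, a MINIMISING
point-stationary layered law does not charge `cubicRoot` — the sandwich
`e(hcp a h) + c ρ_c ≤ E_P[h] ≤ e* ≤ e(hcp a h)` (`eStar_le`). This is the ONLY use of H3 in the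
selection half (cf. `layeredLawsSelectHcp_false_without_energy`). -/
theorem cubicRoot_null_of_selectionInequality (hS : SelectionInequality)
    {P : Measure (Measure E3)} [IsProbabilityMeasure P] (hstat : PointStationary P)
    (hmin : meanRootEnergy P ≤ eStar) (hlay : Layered P) : P cubicRoot = 0 := by
  obtain ⟨a, h, ha, hh, c, hc, hineq⟩ := hS
  have h1 := hineq P inferInstance hstat hlay
  have h2 : eStar ≤ (hcpPeriodicConfiguration ha hh).energyPerParticle lennardJones := eStar_le _
  exact measure_eq_zero_of_mul_toReal_nonpos hc (by linarith)

/-- **The SELECTION HALF as a standalone theorem** (proved from STUBS 1–6): a minimising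
point-stationary layered law is hcp-worded. This is VERBATIM the statement of `stub_haggSelection`
of the sibling skeleton `Lines/mtp_prestress_split_ergodic_frame.lean` (its `HcpCharted S` is
`BarlowLikeWord alternatingHagg S` and its `HcpLayered` is `LayeredHcp`, by `unfold hcpStacking`),
so this line DISCHARGES that line's stub 1, and conversely that line's stubs 2–6 discharge
`stub_hcpWordRigidity` here — the two skeletons are the two halves of one proof. -/
theorem selectionHalf_of (hF : IdealStackingForces) (hH : HaggDominationWithFaults)
    (hR : ReferenceCell) (hZ : HaggDensityStep) (hX : RelaxationStep)
    (hN : NullCubicRootGivesHcpWord) :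
    ∀ P : Measure (Measure E3), IsProbabilityMeasure P → PointStationary P →
      meanRootEnergy P ≤ eStar → Layered P → LayeredHcp P := by
  intro P hP hstat hmin hlay
  have hS : SelectionInequality := selectionInequality_of hF hH hR hZ hX
  exact hN P hP hstat hlay (cubicRoot_null_of_selectionInequality hS hstat hmin hlay)

/-! ## §6 The composition: the seven stubs imply the crux, BY NAME -/

/-- `LayeredLawsSelectHcp` from the seven stubs (pure logic + the proved glue, no `sorry`):
drop H1 (`crux_iff_without_rooted`); STUBS 1–5 give the selection inequality
(`selectionInequality_of`); the sandwich with H3 gives `P(root cubic) = 0`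
(`cubicRoot_null_of_selectionInequality`); STUB 6 makes the law hcp-worded; STUB 7 concludes. -/
theorem LayeredLawsSelectHcp_of (hF : Registered.stub_idealStackingForces)
    (hH : Registered.stub_haggDominationWithFaults) (hR : Registered.stub_referenceCell)
    (hZ : Registered.stub_haggDensityStep) (hX : Registered.stub_relaxationStep)
    (hN : Registered.stub_nullCubicRootGivesHcpWord) (hW : Registered.stub_hcpWordRigidity) :
    LayeredLawsSelectHcp := by
  rw [crux_iff_without_rooted]
  intro P hP hstat hmin hlay
  exact hW P hP hstat hmin (selectionHalf_of hF hH hR hZ hX hN P hP hstat hmin hlay)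

/-- Wiring check: the registered stubs feed `LayeredLawsSelectHcp_of` as stated. -/
example : LayeredLawsSelectHcp :=
  LayeredLawsSelectHcp_of stub_idealStackingForces stub_haggDominationWithFaults stub_referenceCell
    stub_haggDensityStep stub_relaxationStep stub_nullCubicRootGivesHcpWord stub_hcpWordRigidity

end Summit.AtomisticToContinuum.Crystallization.Cruxes.LayeredLawsSelectHcp.StressJumpYoungHaggDensity

end
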